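import Summits.Ventures.PercRepro.RankLevelSetCoreEightOfFormGXT

/-!
# PercRepro — THE LARGE-CORANK REGIME AT LEVEL `8` FROM `p ≥ 112`, WITH LEMMA T5: corank `≥ 188` closes with exact arithmetic
(p2, gen 35; a feeder for S4 — the top of the `q = 8` window, from `126`)

p2 g34's large-corank inequality `largeEight_all` (RankLevelSetCoreEightLargeCorankArith: `p ≥ 144`, `n ≥ p + 172`) re-based
at `p ≥ 112`, `n ≥ p + 188` — the NUMERICAL base `(112, 300)` and the SAME two steps (`largeEight_step_p` along the diagonal
`n = p + 188`, `largeEight_step_n` in `n`; both in the tree, unchanged). Then the `e`-free core at level `8`, rank `p ≥ 112`,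
corank `≥ 188` through `c025_core_eight_large_of_ineq_t` (RankLevelSetCoreEightOfFormGXT).
* **`largeEight_base_gxt`** — the base `(112, 300)`; **`largeEight_all_gxt`** — the inequality for every `p ≥ 112`, `n ≥ p + 188`;
* **`c025_core_eight_large_corank_gxt`** — the core at rank `p ≥ 112`, corank `≥ 188`.
Axioms: standard.
-/

set_option exponentiation.threshold 1024

namespace PercRepro

namespace ThmN

open Set

variable {α : Type}

/-- **The base `(p, n) = (112, 300)`** of the level-`8` large-corank inequality from `112`. -/
theorem largeEight_base_gxt :
    (2 : ℚ) ^ (112 + 159) * ((112 + 188).choose 8 : ℚ) / ((112 + 8).choose 8 : ℚ) +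
    (((112 + 188).choose 8 * 2 ^ 151 + (112 + 188).choose 7 * 2 ^ 72 + (112 + 188).choose 6 * 2 ^ 33 + (112 + 188).choose 5 * 2 ^ 14 + (112 + 188).choose 4 * 2 ^ 6 +
      (112 + 188).choose 3 * 2 ^ 3 + (112 + 188).choose 2 * 2 + (112 + 188) + 1 : ℕ) : ℚ) ≤
    ((∑ k ∈ Finset.Ico 8 112, (112 + 188).choose k : ℕ) : ℚ) := by
  rw [Finset.sum_Ico_eq_sum_range]
  simp only [Finset.sum_range_succ, Finset.sum_range_zero, Nat.choose_eq_descFactorial_div_factorial]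
  norm_num

/-- **The level-`8` large-corank inequality for every `p ≥ 112` and every `n ≥ p + 188`** (the base `(112, 300)`, p2 g34's
steps `largeEight_step_p` / `largeEight_step_n`). -/
theorem largeEight_all_gxt (p : ℕ) (hp : 112 ≤ p) (n : ℕ) (hn : p + 188 ≤ n) :
    (2 : ℚ) ^ (p + 159) * (n.choose 8 : ℚ) / ((p + 8).choose 8 : ℚ) +
    ((n.choose 8 * 2 ^ 151 + n.choose 7 * 2 ^ 72 + n.choose 6 * 2 ^ 33 + n.choose 5 * 2 ^ 14 + n.choose 4 * 2 ^ 6 +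
      n.choose 3 * 2 ^ 3 + n.choose 2 * 2 + n + 1 : ℕ) : ℚ) ≤
    ((∑ k ∈ Finset.Ico 8 p, n.choose k : ℕ) : ℚ) := by
  have hdiag : ∀ p, 112 ≤ p → (2 : ℚ) ^ (p + 159) * ((p + 188).choose 8 : ℚ) / ((p + 8).choose 8 : ℚ) +
      (((p + 188).choose 8 * 2 ^ 151 + (p + 188).choose 7 * 2 ^ 72 + (p + 188).choose 6 * 2 ^ 33 + (p + 188).choose 5 * 2 ^ 14 + (p + 188).choose 4 * 2 ^ 6 +
        (p + 188).choose 3 * 2 ^ 3 + (p + 188).choose 2 * 2 + (p + 188) + 1 : ℕ) : ℚ) ≤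
      ((∑ k ∈ Finset.Ico 8 p, (p + 188).choose k : ℕ) : ℚ) := by
    intro p hp
    induction p, hp using Nat.le_induction with
    | base => exact largeEight_base_gxt
    | succ p hp ih =>
      rw [show p + 1 + 188 = p + 188 + 1 by ring]
      exact largeEight_step_p p (p + 188) (by omega) (by omega) (by omega) ih
  have hall : ∀ n, p + 188 ≤ n → (2 : ℚ) ^ (p + 159) * (n.choose 8 : ℚ) / ((p + 8).choose 8 : ℚ) +
      ((n.choose 8 * 2 ^ 151 + n.choose 7 * 2 ^ 72 + n.choose 6 * 2 ^ 33 + n.choose 5 * 2 ^ 14 + n.choose 4 * 2 ^ 6 +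
        n.choose 3 * 2 ^ 3 + n.choose 2 * 2 + n + 1 : ℕ) : ℚ) ≤
      ((∑ k ∈ Finset.Ico 8 p, n.choose k : ℕ) : ℚ) := by
    intro n hn
    induction n, hn using Nat.le_induction with
    | base => exact hdiag p hp
    | succ n hn ih => exact largeEight_step_n p n (by omega) ih
  exact hall n hn

/-- **THE `e`-FREE CORE AT LEVEL `8`, RANK `p ≥ 112`, CORANK `≥ 188`**: `c025_core_eight_large_of_ineq_t` on `largeEight_all_gxt`. -/
theorem c025_core_eight_large_corank_gxt (M : Matroid α) [M.Finite] (p : ℕ) (hp : 112 ≤ p) (hR : M.eRank = (p : ℕ∞))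
    (hbig : p + 187 < M.E.ncard)
    (hfree : ∀ e ∈ M.E, ∃ A ⊆ M.E \ {e}, e ∉ M.closure A ∧ e ∉ M.closure ((M.E \ {e}) \ A)) :
    RLS M p 8 :=
  c025_core_eight_large_of_ineq_t M p hR (largeEight_all_gxt p hp M.E.ncard (by omega)) hfree

end ThmN

end PercRepro
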